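import Literature.Topology.FourManifolds.ThickenedPlanarHandlebody
import Literature.Geometry.Manifold.LevelSetTwistField
import Literature.Topology.FourManifolds.SublevelPushDown
import Mathlib.Analysis.SpecialFunctions.SmoothTransition
import HarnessLib

/-!
# The level-circle flow of a planar function at fixed heights, with smooth period functions

Topic `Literature/Topology/FourManifolds`; geometric layer of the Dehn-twist package of the
Dehn–Nielsen–Baer seat (`Literature/Geometry/Manifold/LevelSetTwistField.lean`: the flow of the
cut-off tangent field `ψ · v_H` of a complete set of first integrals `H`, its closed orbits and
smooth period functions), specialised to the thickened planar handlebodies of the tree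
(`ThickenedPlanarHandlebody.lean`: `V = {q(x, y) + z² ≤ c} ⊂ ℝ³`, boundary the double
`{q + z² = c}` of the planar domain `{q ≤ c}`).  The first integrals are

  `H(x, y, z) = (q(x, y), z)`                                           (`levelPair q`),

so the closed orbits are the **level circles of `q` at fixed height** — on the boundary surface
`{q + z² = c}`, the level circle `{q = c - h²}` on the sheet `z = h`, i.e. one copy of a
boundary-parallel curve of the planar domain.  Since `q + z²` is a function of `H`, the flow
preserves the handlebody and its boundary surface.

We deliberately do NOT package here "Dehn twists of `ℝ³`" (time-`μ(H)·P(H)` maps of the flow that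
are diffeomorphisms of `ℝ³`): a `q + z²`-preserving diffeomorphism of `ℝ³` preserves `V` and its
complement, so its restriction to `∂V` extends over both and is never the Dehn twist about a curve
bounding a disc on neither side (it is a product `t_c t_{c'}⁻¹` of twists about parallel curves,
isotopically trivial).  The Dehn twist of the SURFACE is glued from the flow in the sequel
`PlanarSurfaceTwist.lean` (`RegularSublevelGlue.lean`); this file supplies the flow package it needs.

Given: `q` smooth with compact sublevel sets; a band of levels `(s₁ - 2δ, s₂ + 2δ)` without critical
points of `q`; heights `h₁ ≤ h₂`; a smooth transversal `γ` to the level curves parametrised by the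
level (`q(γ s) = s` on the band) selecting one circle in each level; `(s₀, h₀)` in
`[s₁, s₂] × [h₁, h₂]`.  We construct:

* `levelPair`, `contDiff_levelPair`, `hasFDerivAt_levelPair`, `range_fderiv_levelPair_eq_top`
  (`DH` is onto wherever `dq ≠ 0`), `isCompact_levelPair_preimage` (the level sets
  `{q = s} × {h}` are compact), `thicken_eq_of_levelPair_eq`; the bases `bE3`, `bF2`;
* `exists_planarLevelPackage` — a smooth cut-off `ψ`, `= 1` on the `δ`-box
  `{H ∈ (s₁ - δ, s₂ + δ) × (h₁ - δ, h₂ + δ)}` and `= 0` off the `2δ`-box; the smooth complete flow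
  `θ` of `ψ · v_H` (`v_H = twistField bE3 bF2 H ψ / ψ` the tangent field of the level circles:
  the integral curves of `θ` have velocity `twistField bE3 bF2 (levelPair q) ψ`), preserving `H`
  and fixing `{ψ = 0}` pointwise; ONE positive period of the circle through
  `σ(s₀, h₀) = (γ s₀, h₀)`; and for EVERY positive period `T₀` of it a smooth positive period
  function `P` on an open parameter set `S ∋ (s₀, h₀)` inside the `δ`-box with `P(s₀, h₀) = T₀`,
  `θ(P(s), σ s) = σ s`, the family `flowSaturation θ σ S` of the circles through `σ(S)` being
  open in `ℝ³`.

Everything is proved; definitions `levelPair`, `bE3`, `bF2`; no named facts (D-0026).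

## References

* B. Farb, D. Margalit, *A primer on mapping class groups*, PMS 49 (2012), §3.1.1 (PDF p. 62: the
  twist map on an annulus of closed curves). [FarbMargalit2012]
* J. Milnor, *Topology from the Differentiable Viewpoint* (1965), §2 Lemma 1 (flows of compactly
  supported vector fields). [MilnorTDV1965]
-/
open scoped Manifold ContDiff Topology
open Set Function Filter Metric

noncomputable section

namespace Literature.Topology.FourManifolds

open PlanarThickening Literature.Geometry.Manifold

/-- Local notation: `𝔼 n` is the model Euclidean space `EuclideanSpace ℝ (Fin n)`. -/
local notation "𝔼 " n:arg => EuclideanSpace ℝ (Fin n)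

namespace PlanarLevelTwist

variable {q : 𝔼 2 → ℝ}

/-! ### §1 The first integrals `H = (q ∘ π, z)` -/

/-- **The first integrals** `H(x, y, z) = (q(x, y), z)`. [folklore] -/
def levelPair (q : 𝔼 2 → ℝ) (x : 𝔼 3) : ℝ × ℝ := (q (proj x), x 2)

/-- Unfolding. [folklore] -/
@[simp] theorem levelPair_apply (q : 𝔼 2 → ℝ) (x : 𝔼 3) : levelPair q x = (q (proj x), x 2) := rfl

/-- The thickening `q + z²` is a function of `H`. [folklore] -/
theorem thicken_eq_of_levelPair_eq {x y : 𝔼 3} (h : levelPair q x = levelPair q y) :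
    thicken q x = thicken q y := by
  simp only [levelPair_apply, Prod.mk.injEq] at h
  rw [thicken_apply, thicken_apply, h.1, h.2]

/-- `H` is smooth for smooth `q`. [folklore] -/
theorem contDiff_levelPair (hq : ContDiff ℝ ∞ q) : ContDiff ℝ ∞ (levelPair q) :=
  (hq.comp proj.contDiff).prodMk zc.contDiff

/-- **The differential of `H`**: `dH_x(w) = (dq_{π x}(π w), w₂)`. [folklore] -/
theorem hasFDerivAt_levelPair {q' : 𝔼 2 →L[ℝ] ℝ} {x : 𝔼 3} (hq : HasFDerivAt q q' (proj x)) :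
    HasFDerivAt (levelPair q) ((q'.comp proj).prod (zc : 𝔼 3 →L[ℝ] ℝ)) x :=
  (hasFDerivAt_comp_proj hq).prodMk zc.hasFDerivAt

/-- **`dH_x` is onto wherever `dq_{π x} ≠ 0`.** [folklore] -/
theorem range_fderiv_levelPair_eq_top (hq : Differentiable ℝ q) {x : 𝔼 3}
    (hx : fderiv ℝ q (proj x) ≠ 0) :
    LinearMap.range (fderiv ℝ (levelPair q) x : 𝔼 3 →ₗ[ℝ] ℝ × ℝ) = ⊤ := by
  rw [(hasFDerivAt_levelPair (hq (proj x)).hasFDerivAt).fderiv]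
  obtain ⟨u, hu⟩ : ∃ u : 𝔼 2, fderiv ℝ q (proj x) u ≠ 0 := by
    by_contra h
    push Not at h
    exact hx (ContinuousLinearMap.ext fun u => by simpa using h u)
  rw [LinearMap.range_eq_top]
  rintro ⟨a, b⟩
  refine ⟨(a / fderiv ℝ q (proj x) u) • lift u + b • ez, Prod.ext ?_ ?_⟩
  · simp [proj_lift, proj_ez, div_mul_cancel₀ a hu]
  · simp

/-- **The level sets of `H` are compact** when the sublevel sets of `q` are: `{q = s} × {h}`.
[folklore] -/
theorem isCompact_levelPair_preimage (hqc : Continuous q) (hcoer : ∀ s, IsCompact (q ⁻¹' Iic s))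
    (s h : ℝ) : IsCompact (levelPair q ⁻¹' {(s, h)}) := by
  obtain ⟨R, hR⟩ := (hcoer s).isBounded.subset_closedBall 0
  refine Metric.isCompact_of_isClosed_isBounded ?_ ?_
  · exact isClosed_singleton.preimage ((hqc.comp proj.continuous).prodMk zc.continuous)
  · refine (isBounded_closedBall (x := (0 : 𝔼 3)) (r := |R| + |h|)).subset fun x hx => ?_
    simp only [mem_preimage, levelPair_apply, mem_singleton_iff, Prod.mk.injEq] at hx
    have hp : proj x ∈ closedBall (0 : 𝔼 2) R := hR (by simp [hx.1])
    rw [mem_closedBall, dist_zero_right] at hp ⊢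
    have hdecomp : x = lift (proj x) + x 2 • ez := (lift_proj_add x).symm
    have hlift : ‖lift (proj x)‖ ≤ |R| := by
      have : ‖lift (proj x)‖ = ‖proj x‖ := by
        rw [EuclideanSpace.norm_eq, EuclideanSpace.norm_eq]
        congr 1
        simp [Fin.sum_univ_three, Fin.sum_univ_two]
      rw [this]; exact hp.trans (le_abs_self R)
    calc ‖x‖ = ‖lift (proj x) + x 2 • ez‖ := by rw [← hdecomp]
      _ ≤ ‖lift (proj x)‖ + ‖x 2 • ez‖ := norm_add_le _ _
      _ ≤ |R| + |h| := by
        refine add_le_add hlift ?_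
        rw [norm_smul, hx.2, Real.norm_eq_abs]
        have : ‖ez‖ = 1 := by
          rw [EuclideanSpace.norm_eq]; simp [Fin.sum_univ_three]
        rw [this, mul_one]

/-! ### §2 Bases of `ℝ³` and `ℝ²` indexed for the cross product -/

/-- The standard basis of `ℝ³`, indexed by `Fin 2 ⊕ Fin 1`. [folklore] -/
def bE3 : Module.Basis (Fin 2 ⊕ Fin 1) ℝ (𝔼 3) :=
  (EuclideanSpace.basisFun (Fin 3) ℝ).toBasis.reindex (finSumFinEquiv : Fin 2 ⊕ Fin 1 ≃ Fin 3).symm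

/-- The standard basis of `ℝ × ℝ`. [folklore] -/
def bF2 : Module.Basis (Fin 2) ℝ (ℝ × ℝ) := Module.Basis.finTwoProd ℝ

/-! ### §3 The level-circle flow and its period functions (cut-off `ψ = χ(q) χ'(z)`, the plateau
functions `χ, χ'` being `exists_plateau` of `SublevelPushDown.lean`) -/

/-- **The level-circle flow of a planar function with its smooth period functions** (see the file
header): the smooth cut-off `ψ` (`= 1` on the `δ`-box of `H = (q ∘ π, z)`, `= 0` off the `2δ`-box),
the smooth complete flow `θ` of `ℝ³` whose integral curves have velocity
`twistField bE3 bF2 H ψ = ψ · v_H`, preserving `H` and fixing `{ψ = 0}` pointwise, ONE positive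
period of the circle through `σ(s₀, h₀) = (γ s₀, h₀)`, and for EVERY positive period `T₀` of it a
smooth positive period function `P` on an open parameter set `S ∋ (s₀, h₀)` inside the `δ`-box with
`P(s₀, h₀) = T₀`, the family of circles through `σ(S)` being open in `ℝ³`.
[cite: FarbMargalit2012, §3.1.1] [cite: MilnorTDV1965, §2 Lemma 1] -/
theorem exists_planarLevelPackage (hq : ContDiff ℝ ∞ q) (hcoer : ∀ s, IsCompact (q ⁻¹' Iic s))
    {s₁ s₂ h₁ h₂ δ : ℝ} (hδ : 0 < δ)
    (hreg : ∀ p, q p ∈ Ioo (s₁ - 2 * δ) (s₂ + 2 * δ) → fderiv ℝ q p ≠ 0)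
    {γ : ℝ → 𝔼 2} (hγ : ContDiff ℝ ∞ γ) (hqγ : ∀ s ∈ Ioo (s₁ - 2 * δ) (s₂ + 2 * δ), q (γ s) = s)
    {s₀ h₀ : ℝ} (hs₀ : s₀ ∈ Icc s₁ s₂) (hh₀ : h₀ ∈ Icc h₁ h₂) :
    ∃ (ψ : 𝔼 3 → ℝ) (θ : ℝ × 𝔼 3 → 𝔼 3), ContDiff ℝ ∞ ψ ∧
      (∀ x, levelPair q x ∈ Ioo (s₁ - δ) (s₂ + δ) ×ˢ Ioo (h₁ - δ) (h₂ + δ) → ψ x = 1) ∧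
      (∀ x, (q (proj x) ∉ Ioo (s₁ - 2 * δ) (s₂ + 2 * δ) ∨ x 2 ∉ Ioo (h₁ - 2 * δ) (h₂ + 2 * δ)) →
        ψ x = 0) ∧
      ContDiff ℝ ∞ θ ∧ (∀ x, θ (0, x) = x) ∧ (∀ t s x, θ (t, θ (s, x)) = θ (t + s, x)) ∧
      (∀ x t, HasDerivAt (fun t => θ (t, x)) (twistField bE3 bF2 (levelPair q) ψ (θ (t, x))) t) ∧
      (∀ t x, levelPair q (θ (t, x)) = levelPair q x) ∧
      (∀ x, ψ x = 0 → ∀ t, θ (t, x) = x) ∧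
      (∃ T₀ : ℝ, 0 < T₀ ∧ θ (T₀, lift (γ s₀) + h₀ • ez) = lift (γ s₀) + h₀ • ez) ∧
      ∀ T₀ : ℝ, 0 < T₀ → θ (T₀, lift (γ s₀) + h₀ • ez) = lift (γ s₀) + h₀ • ez →
        ∃ (P : ℝ × ℝ → ℝ) (S : Set (ℝ × ℝ)), IsOpen S ∧ (s₀, h₀) ∈ S ∧
          S ⊆ Ioo (s₁ - δ) (s₂ + δ) ×ˢ Ioo (h₁ - δ) (h₂ + δ) ∧ ContDiffOn ℝ ∞ P S ∧
          P (s₀, h₀) = T₀ ∧ (∀ s ∈ S, 0 < P s) ∧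
          (∀ s ∈ S, θ (P s, lift (γ s.1) + s.2 • ez) = lift (γ s.1) + s.2 • ez) ∧
          IsOpen (flowSaturation θ (fun s : ℝ × ℝ => lift (γ s.1) + s.2 • ez) S) := by
  -- the plateaus and the cut-off
  obtain ⟨χ, hχs, hχ01, hχ1, hχsupp⟩ := exists_plateau (a := s₁) (b := s₂) hδ
  obtain ⟨χ', hχ's, hχ'01, hχ'1, hχ'supp⟩ := exists_plateau (a := h₁) (b := h₂) hδ
  set ψ : 𝔼 3 → ℝ := fun x => χ (q (proj x)) * χ' (x 2) with hψdef
  have hψs : ContDiff ℝ ∞ ψ :=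
    (hχs.comp (hq.comp proj.contDiff)).mul (hχ's.comp zc.contDiff)
  have hψzero : ∀ x, (q (proj x) ∉ Ioo (s₁ - 2 * δ) (s₂ + 2 * δ) ∨
      x 2 ∉ Ioo (h₁ - 2 * δ) (h₂ + 2 * δ)) → ψ x = 0 := by
    intro x hx
    rcases hx with hx | hx
    · have : χ (q (proj x)) = 0 := by by_contra h; exact hx (hχsupp _ h)
      simp [hψdef, this]
    · have : χ' (x 2) = 0 := by by_contra h; exact hx (hχ'supp _ h)
      simp [hψdef, this]
  -- compact support
  set K : Set (𝔼 3) := levelPair q ⁻¹' (Icc (s₁ - 2 * δ) (s₂ + 2 * δ) ×ˢ Icc (h₁ - 2 * δ) (h₂ + 2 * δ))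
    with hKdef
  have hKc : IsCompact K := by
    obtain ⟨R, hR⟩ := (hcoer (s₂ + 2 * δ)).isBounded.subset_closedBall 0
    refine Metric.isCompact_of_isClosed_isBounded ?_ ?_
    · exact (isClosed_Icc.prod isClosed_Icc).preimage (contDiff_levelPair hq).continuous
    · refine (isBounded_closedBall (x := (0 : 𝔼 3))
        (r := |R| + (|h₁ - 2 * δ| + |h₂ + 2 * δ|))).subset fun x hx => ?_
      simp only [hKdef, mem_preimage, levelPair_apply, mem_prod, mem_Icc] at hx
      have hp : proj x ∈ closedBall (0 : 𝔼 2) R := hR (by simpa using hx.1.2)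
      rw [mem_closedBall, dist_zero_right] at hp ⊢
      have hdecomp : x = lift (proj x) + x 2 • ez := (lift_proj_add x).symm
      have hlift : ‖lift (proj x)‖ ≤ |R| := by
        have : ‖lift (proj x)‖ = ‖proj x‖ := by
          rw [EuclideanSpace.norm_eq, EuclideanSpace.norm_eq]
          congr 1
          simp [Fin.sum_univ_three, Fin.sum_univ_two]
        rw [this]; exact hp.trans (le_abs_self R)
      have hz : |x 2| ≤ |h₁ - 2 * δ| + |h₂ + 2 * δ| := by
        rcases le_or_gt 0 (x 2) with h0 | h0
        · rw [abs_of_nonneg h0]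
          exact le_trans hx.2.2 ((le_abs_self _).trans (le_add_of_nonneg_left (abs_nonneg _)))
        · rw [abs_of_neg h0]
          have : -(x 2) ≤ |h₁ - 2 * δ| := by
            have := hx.2.1; have := neg_abs_le (h₁ - 2 * δ); linarith
          exact this.trans (le_add_of_nonneg_right (abs_nonneg _))
      calc ‖x‖ = ‖lift (proj x) + x 2 • ez‖ := by rw [← hdecomp]
        _ ≤ ‖lift (proj x)‖ + ‖x 2 • ez‖ := norm_add_le _ _
        _ ≤ |R| + (|h₁ - 2 * δ| + |h₂ + 2 * δ|) := by
          refine add_le_add hlift ?_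
          rw [norm_smul, Real.norm_eq_abs]
          have : ‖ez‖ = 1 := by
            rw [EuclideanSpace.norm_eq]; simp [Fin.sum_univ_three]
          rw [this, mul_one]
          exact hz
  have hψK : ∀ x, x ∉ K → ψ x = 0 := by
    intro x hx
    apply hψzero
    by_contra hcon
    push Not at hcon
    exact hx ⟨⟨hcon.1.1.le, hcon.1.2.le⟩, ⟨hcon.2.1.le, hcon.2.2.le⟩⟩
  -- the open set `U` on which `ψ = 1`, and regularity there
  set U : Set (𝔼 3) := levelPair q ⁻¹' (Ioo (s₁ - δ) (s₂ + δ) ×ˢ Ioo (h₁ - δ) (h₂ + δ)) with hUdef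
  have hUo : IsOpen U := (isOpen_Ioo.prod isOpen_Ioo).preimage (contDiff_levelPair hq).continuous
  have hψU : ∀ x ∈ U, ψ x = 1 := by
    intro x hx
    simp only [hUdef, mem_preimage, levelPair_apply, mem_prod, mem_Ioo] at hx
    simp only [hψdef]
    rw [hχ1 _ ⟨hx.1.1.le, hx.1.2.le⟩, hχ'1 _ ⟨hx.2.1.le, hx.2.2.le⟩, mul_one]
  have hband : ∀ x ∈ U, q (proj x) ∈ Ioo (s₁ - 2 * δ) (s₂ + 2 * δ) := by
    intro x hx
    simp only [hUdef, mem_preimage, levelPair_apply, mem_prod, mem_Ioo] at hx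
    exact ⟨by linarith [hx.1.1], by linarith [hx.1.2]⟩
  have hregU : ∀ x ∈ U, levelPair q x = (s₀, h₀) →
      LinearMap.range (fderiv ℝ (levelPair q) x : 𝔼 3 →ₗ[ℝ] ℝ × ℝ) = ⊤ := fun x hx _ =>
    range_fderiv_levelPair_eq_top (hq.differentiable (by simp)) (hreg _ (hband x hx))
  -- the section
  set σ : ℝ × ℝ → 𝔼 3 := fun s => lift (γ s.1) + s.2 • ez with hσdef
  have hσs : ContDiff ℝ ∞ σ :=
    (lift.contDiff.comp (hγ.comp contDiff_fst)).add (contDiff_snd.smul contDiff_const)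
  set J : Set (ℝ × ℝ) := Ioo (s₁ - δ) (s₂ + δ) ×ˢ Ioo (h₁ - δ) (h₂ + δ) with hJdef
  have hJo : IsOpen J := isOpen_Ioo.prod isOpen_Ioo
  have hs₀J : (s₀, h₀) ∈ J :=
    ⟨⟨by linarith [hs₀.1], by linarith [hs₀.2]⟩, ⟨by linarith [hh₀.1], by linarith [hh₀.2]⟩⟩
  have hHσ : ∀ s ∈ J, levelPair q (σ s) = s := by
    rintro ⟨s, h⟩ ⟨hs, -⟩
    simp only [hσdef, levelPair_apply, map_add, map_smul, proj_lift, proj_ez, smul_zero, add_zero]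
    rw [hqγ s ⟨by linarith [hs.1], by linarith [hs.2]⟩]
    ext <;> simp
  have hσU : ∀ s ∈ J, σ s ∈ U := by
    intro s hs
    show levelPair q (σ s) ∈ Ioo (s₁ - δ) (s₂ + δ) ×ˢ Ioo (h₁ - δ) (h₂ + δ)
    rw [hHσ s hs]; exact hs
  have hψσ : ∀ s ∈ J, ψ (σ s) ≠ 0 := fun s hs => by rw [hψU _ (hσU s hs)]; exact one_ne_zero
  have hregσ : ∀ s ∈ J, LinearMap.range (fderiv ℝ (levelPair q) (σ s) : 𝔼 3 →ₗ[ℝ] ℝ × ℝ) = ⊤ :=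
    fun s hs => range_fderiv_levelPair_eq_top (hq.differentiable (by simp)) (hreg _ (hband _ (hσU s hs)))
  -- compactness of the level component
  have hcpt : IsCompact (connectedComponentIn (U ∩ levelPair q ⁻¹' {(s₀, h₀)}) (σ (s₀, h₀))) := by
    have hL : IsCompact (U ∩ levelPair q ⁻¹' {(s₀, h₀)}) := by
      have hsub : U ∩ levelPair q ⁻¹' {(s₀, h₀)} = levelPair q ⁻¹' {(s₀, h₀)} := by
        refine inter_eq_right.2 fun x hx => ?_
        simp only [mem_preimage, mem_singleton_iff] at hx
        show levelPair q x ∈ Ioo (s₁ - δ) (s₂ + δ) ×ˢ Ioo (h₁ - δ) (h₂ + δ)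
        rw [hx]; exact hs₀J
      rw [hsub]
      exact isCompact_levelPair_preimage hq.continuous hcoer s₀ h₀
    have hzL : σ (s₀, h₀) ∈ U ∩ levelPair q ⁻¹' {(s₀, h₀)} :=
      ⟨hσU _ hs₀J, by simp only [mem_preimage, mem_singleton_iff]; exact hHσ _ hs₀J⟩
    haveI : CompactSpace (U ∩ levelPair q ⁻¹' {(s₀, h₀)} : Set (𝔼 3)) := isCompact_iff_compactSpace.1 hL
    rw [connectedComponentIn_eq_image hzL]
    exact (isClosed_connectedComponent.isCompact).image continuous_subtype_val
  -- the flow, the velocity along the transversal, one period, the period functions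
  obtain ⟨θ, hθ, h0, hadd, hint, hfix, hHinv, hψfix⟩ :=
    exists_levelFlow (bE := bE3) (bF := bF2) (contDiff_levelPair hq) hψs hKc hψK
  have hvel : ∀ u : ℝ, ∀ s ∈ J, ∃ v : 𝔼 3, v ≠ 0 ∧ HasDerivAt (fun t => θ (t, σ s)) v u :=
    exists_velocity_ne_zero h0 hadd hfix hint fun s hs => twistField_ne_zero (hψσ s hs) (hregσ s hs)
  obtain ⟨T₁, hT₁, hT₁per⟩ :=
    exists_pos_period_of_isCompact_connectedComponentIn (bE := bE3) (bF := bF2)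
      (contDiff_levelPair hq) hψs h0 hadd hint hUo hψU hregU (hσU _ hs₀J) (hHσ _ hs₀J) hcpt
  refine ⟨ψ, θ, hψs, fun x hx => hψU x hx, hψzero, hθ, h0, hadd, hint, hHinv, hψfix,
    ⟨T₁, hT₁, hT₁per⟩, fun T₀ hT₀ hT => ?_⟩
  obtain ⟨P, S, hSo, hs₀S, hSJ, hPs, hP0, hPpos, -, hPS, hopen, -⟩ :=
    exists_period_package (finrank_eq_of_bases bE3 bF2) hθ h0 hadd (contDiff_levelPair hq) hHinv
      hσs hJo hs₀J hHσ hT₀ hT hvel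
  exact ⟨P, S, hSo, hs₀S, hSJ, hPs, hP0, hPpos, hPS, hopen⟩


end PlanarLevelTwist

end Literature.Topology.FourManifolds

end
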